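import Mathlib
import HarnessLib
import Literature.MathematicalPhysics.QuantumFieldTheory.ConstructiveQFTWave0
import Summits.Ventures.LatticeQCDFlow.Exactness.LatticeCoordAvg
import Summits.Ventures.LatticeQCDFlow.TrivializingMaps.WilsonNonInteractingLinks
import Summits.Ventures.LatticeQCDFlow.Scaling.AutoregressiveGaugeRedundancy

/-!
# LatticeQCDFlow / Scaling — gauge redundancy of the autoregressive context, III: links generated
# along a matching are invisible, and the next link is exactly Haar (a volume-order gap between the
# symbolic and the true context)

HONEST FRAMING: exact (Metropolis-corrected) sampling algorithms for lattice gauge theory;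
figures of merit are autocorrelation/cost numbers at stated couplings and volumes; no
continuum-physics claim.

Venture `LatticeQCDFlow` (cell pub-lqcd), topic `Scaling`, FANOUT row 30 (lean-1, GEN-15) — OUR WORK,
third file on THEORY-2.md §4 row C5 for GAUGE links (mechanism: `Scaling/AutoregressiveGaugeRedundancy`;
plaquette-mate witness: `Scaling/AutoregressiveGaugeRedundancyWilson`).  The mechanism file shows that
a generated link BURIED by the not-yet-generated links drops out of every later exact conditional.
Here the burial is applied to a whole family at once:

* §1 **`coordAvg_eq_of_private_endpoints`** — let the generated links be `M` and the next link `a`;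
  if every `ℓ ∈ M` is not a loop and has a PRIVATE endpoint (touched by no other link of `M ∪ {a}`),
  then for every gauge-invariant weight `F` the two marginals `A_s F`, `A_{insert a s} F`
  (`s = (M ∪ {a})ᶜ` the links still to be generated) read NONE of the links of `M`; if moreover `a`
  is not a loop and touches no link of `M` at one of its endpoints, `A_s F` does not read `U_a` either
  (`coordAvg_update_next_eq`), so **`arConditional_const_of_private_endpoints`**: the exact
  conditional density `A_s F / A_{insert a s} F` of `U_a` given `U_M` is CONSTANT in `(U_a, U_M)` —
  the `(|M| + 1)`-st generated link is exactly Haar and independent of everything generated so far.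
  (Matchings — pairwise endpoint-disjoint links — have private endpoints at both ends; so do the
  leaves of any forest of generated links.  The forest statement "links generated along a forest are
  i.i.d. Haar", the autoregressive form of maximal-tree gauge fixing, is NOT typed here beyond leaves.)
* §2 THE VOLUME-ORDER INSTANCE on `(ℤ/L)^d`, `L ≥ 2`: lean-2 GEN-9's family `evenLinks i₀` (the
  `⌊L/2⌋^d` direction-`i₀` links based on the even sublattice, tree
  `TrivializingMaps/WilsonNonInteractingLinks`) is pairwise ENDPOINT-DISJOINT
  (`evenLinks_endpoint_disjoint`); **`wilson_arConditional_const_after_evenLinks`**: for the Wilson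
  weight of every compact `G`, `ρ`, real `β`: generate first the links of `evenLinks i₀` that do not
  touch the endpoints of `a` (all but at most the ones at `a`'s two endpoints), then `a`: the exact
  conditional of `U_a` is constant — Haar — and reads none of the `≍ (L/2)^d` generated links, although
  in the plaquette-sharing graph every one of them is joined to `a` through not-yet-generated links
  (the symbolic context of `a` is all of them as soon as the ungenerated links connect `a` to their
  plaquettes, which they do: only a vertex-disjoint family has been removed).

READING (value-free, for THEORY-2 §4 C5 / T2-AF): for gauge links the gap between the symbolic
(fill-neighbourhood) context and the true context of an exact autoregressive sampler is not a
boundary effect: along orders that begin with a matching it is of the order of the VOLUME at the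
`(|M|+1)`-st step, where the true context is EMPTY and the conditional is Haar — the autoregressive
face of "links on a forest are pure gauge" (maximal-tree gauge, M. Creutz, *Quarks, gluons and
lattices* (1983) Ch. 9, integrated form in the tree's `Scaling/LatticeTreeGauge`).  Any faithful
context count for gauge theories (C5 repaired) must therefore be stated for gauge-invariant content.
NOT CLAIMED: the forest (beyond leaves) statement; any count of the symbolic context (graph
connectivity is described, not typed); anything in `d ≥ 3` about lower bounds; any number of ours.
Elementary over the tree; no definition is introduced; nothing is cited as a fact; no `sorry`.
-/

noncomputable section

namespace Summit.Ventures.LatticeQCDFlow.Theory2.Autoregressive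

open MeasureTheory Function
open Literature.MathematicalPhysics.QuantumFieldTheory
open Summit.Ventures.LatticeQCDFlow.Exactness

variable {d L N : ℕ} {G : Type*} [Group G]

/-! ## §1 Generated links with private endpoints are invisible; the next link is Haar -/

section Private

variable [TopologicalSpace G] [IsTopologicalGroup G] [CompactSpace G] [MeasurableSpace G]
  [BorelSpace G]

/-- **Links with private endpoints are invisible.**  Generated links `M`, next link `a`, links still
to be generated `s = (insert a M)ᶜ`.  If every `ℓ ∈ M` is not a loop and has an endpoint `x` touched
by no other link of `insert a M`, then for gauge-invariant `F` the marginal `A_s F` reads none of the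
links of `M`: configurations agreeing off `M` have the same marginal. [ours] -/
theorem coordAvg_eq_of_private_endpoints [NeZero L] {F : GaugeConfig d L G → ℝ}
    (hF : IsGaugeInvariant F) (M : Finset (Edge d L)) (a : Edge d L)
    (hM : ∀ ℓ ∈ M, ℓ.1 ≠ ℓ.1.shift ℓ.2 ∧ ∃ x : Site d L, (ℓ.1 = x ∨ ℓ.1.shift ℓ.2 = x) ∧
      ∀ e : Edge d L, e.1 = x ∨ e.1.shift e.2 = x → e ≠ ℓ → e ∉ insert a M)
    {U U' : GaugeConfig d L G} (h : ∀ e, e ∉ M → U e = U' e) :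
    coordAvg (haarProbability G) (Finset.univ \ insert a M) F U =
      coordAvg (haarProbability G) (Finset.univ \ insert a M) F U' := by
  refine coordAvg_eq_of_forall_buried hF M (fun ℓ hℓ => ?_) fun e _ heM => h e heM
  obtain ⟨hloop, x, hinc, hpriv⟩ := hM ℓ hℓ
  exact ⟨hloop, x, hinc, fun e he hne => Finset.mem_sdiff.2 ⟨Finset.mem_univ _, hpriv e he hne⟩⟩

/-- The same for the DENOMINATOR marginal `A_{insert a s} F = A_{Mᶜ} F` (the set `insert a s` is
`Mᶜ`; a private endpoint w.r.t. `insert a M` is private w.r.t. `M`). [ours] -/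
theorem coordAvg_compl_eq_of_private_endpoints [NeZero L] {F : GaugeConfig d L G → ℝ}
    (hF : IsGaugeInvariant F) (M : Finset (Edge d L)) (a : Edge d L)
    (hM : ∀ ℓ ∈ M, ℓ.1 ≠ ℓ.1.shift ℓ.2 ∧ ∃ x : Site d L, (ℓ.1 = x ∨ ℓ.1.shift ℓ.2 = x) ∧
      ∀ e : Edge d L, e.1 = x ∨ e.1.shift e.2 = x → e ≠ ℓ → e ∉ insert a M)
    {U U' : GaugeConfig d L G} (h : ∀ e, e ∉ M → U e = U' e) :
    coordAvg (haarProbability G) (Finset.univ \ M) F U =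
      coordAvg (haarProbability G) (Finset.univ \ M) F U' := by
  refine coordAvg_eq_of_forall_buried hF M (fun ℓ hℓ => ?_) fun e _ heM => h e heM
  obtain ⟨hloop, x, hinc, hpriv⟩ := hM ℓ hℓ
  refine ⟨hloop, x, hinc, fun e he hne => Finset.mem_sdiff.2 ⟨Finset.mem_univ _, fun heM => ?_⟩⟩
  exact hpriv e he hne (Finset.mem_insert_of_mem heM)

/-- `insert a ((insert a M)ᶜ) = Mᶜ` when `a ∉ M`. [ours] -/
theorem insert_sdiff_insert_eq [NeZero L] {M : Finset (Edge d L)} {a : Edge d L} (ha : a ∉ M) :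
    insert a (Finset.univ \ insert a M) = Finset.univ \ M := by
  ext e
  simp only [Finset.mem_insert, Finset.mem_sdiff, Finset.mem_univ, true_and, not_or]
  constructor
  · rintro (rfl | ⟨_, h2⟩)
    · exact ha
    · exact h2
  · intro he
    by_cases hea : e = a
    · exact Or.inl hea
    · exact Or.inr ⟨hea, he⟩

/-- **The next link is not read either**: if `a` is not a loop and NO link of `M` touches the
endpoint `y` of `a`, then `A_s F` (`s = (insert a M)ᶜ`) does not depend on `U_a` (burial of `a` at
`y`). [ours] -/
theorem coordAvg_update_next_eq [NeZero L] {F : GaugeConfig d L G → ℝ} (hF : IsGaugeInvariant F)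
    (M : Finset (Edge d L)) {a : Edge d L} {y : Site d L} (hloop : a.1 ≠ a.1.shift a.2)
    (hinc : a.1 = y ∨ a.1.shift a.2 = y)
    (hy : ∀ e ∈ M, ¬ (e.1 = y ∨ e.1.shift e.2 = y)) (U : GaugeConfig d L G) (g : G) :
    coordAvg (haarProbability G) (Finset.univ \ insert a M) F (update U a g) =
      coordAvg (haarProbability G) (Finset.univ \ insert a M) F U := by
  refine coordAvg_update_of_buried hF hinc hloop (fun e he hne => ?_) U g
  refine Finset.mem_sdiff.2 ⟨Finset.mem_univ _, fun hmem => ?_⟩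
  rcases Finset.mem_insert.1 hmem with rfl | heM
  · exact hne rfl
  · exact hy e heM he

/-- **THE EXACT CONDITIONAL OF THE NEXT LINK IS CONSTANT (HAAR) AND READS NOTHING.**  Generated
links `M` with private endpoints (w.r.t. `insert a M`), next link `a ∉ M`, not a loop, with an
endpoint `y` touched by no link of `M`; `s = (insert a M)ᶜ`.  Then for every gauge-invariant `F` the
exact conditional density `A_s F / A_{insert a s} F` of `U_a` given `U_M` takes the same value on any
two configurations that agree off `insert a M` — it is constant in `(U_a, U_M)`: the `(|M|+1)`-st
generated link is exactly Haar, whatever `M` showed. [ours] -/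
theorem arConditional_const_of_private_endpoints [NeZero L] {F : GaugeConfig d L G → ℝ}
    (hF : IsGaugeInvariant F) (M : Finset (Edge d L)) {a : Edge d L} (ha : a ∉ M)
    (hM : ∀ ℓ ∈ M, ℓ.1 ≠ ℓ.1.shift ℓ.2 ∧ ∃ x : Site d L, (ℓ.1 = x ∨ ℓ.1.shift ℓ.2 = x) ∧
      ∀ e : Edge d L, e.1 = x ∨ e.1.shift e.2 = x → e ≠ ℓ → e ∉ insert a M)
    {y : Site d L} (hloop : a.1 ≠ a.1.shift a.2) (hinc : a.1 = y ∨ a.1.shift a.2 = y)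
    (hy : ∀ e ∈ M, ¬ (e.1 = y ∨ e.1.shift e.2 = y))
    {U U' : GaugeConfig d L G} (h : ∀ e, e ∉ insert a M → U e = U' e) :
    coordAvg (haarProbability G) (Finset.univ \ insert a M) F U /
        coordAvg (haarProbability G) (insert a (Finset.univ \ insert a M)) F U =
      coordAvg (haarProbability G) (Finset.univ \ insert a M) F U' /
        coordAvg (haarProbability G) (insert a (Finset.univ \ insert a M)) F U' := by
  rw [insert_sdiff_insert_eq ha]
  -- numerator: move `U_a` to `U'_a` (burial of `a`), then the `M`-links (private endpoints)
  have hnum : coordAvg (haarProbability G) (Finset.univ \ insert a M) F U =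
      coordAvg (haarProbability G) (Finset.univ \ insert a M) F U' := by
    rw [← coordAvg_update_next_eq hF M hloop hinc hy U (U' a)]
    refine coordAvg_eq_of_private_endpoints hF M a hM fun e heM => ?_
    by_cases hea : e = a
    · subst hea; rw [update_self]
    · rw [update_of_ne hea]
      exact h e (by simp [hea, heM])
  -- denominator: `A_{Mᶜ} F` does not read `U_a` (it integrates it) nor `U_M`
  have hden : coordAvg (haarProbability G) (Finset.univ \ M) F U =
      coordAvg (haarProbability G) (Finset.univ \ M) F U' := by
    rw [coordAvg_congr_off (Finset.univ \ M) F (U' := update U a (U' a)) fun e he => ?_]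
    · refine coordAvg_compl_eq_of_private_endpoints hF M a hM fun e heM => ?_
      by_cases hea : e = a
      · subst hea; rw [update_self]
      · rw [update_of_ne hea]
        exact h e (by simp [hea, heM])
    · have hea : e ≠ a := by
        intro hea
        subst hea
        exact he (Finset.mem_sdiff.2 ⟨Finset.mem_univ _, ha⟩)
      rw [update_of_ne hea]
  rw [hnum, hden]

end Private

/-! ## §2 The volume-order instance: the even-sublattice links of one direction -/

section EvenLinks

open Summit.Ventures.LatticeQCDFlow.TrivializingMaps

/-- **`evenLinks i₀` is pairwise ENDPOINT-DISJOINT** (lean-2 GEN-9's family of `⌊L/2⌋^d` links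
`(2x, i₀)`: two different ones share no endpoint — parity in the `i₀` coordinate, no wrap-around). [ours] -/
theorem evenLinks_endpoint_disjoint [NeZero L] (i₀ : Fin d) {e e' : Edge d L}
    (he : e ∈ evenLinks (L := L) i₀) (he' : e' ∈ evenLinks (L := L) i₀) (hne : e ≠ e') :
    e.1 ≠ e'.1 ∧ e.1 ≠ e'.1.shift e'.2 ∧ e.1.shift e.2 ≠ e'.1 ∧ e.1.shift e.2 ≠ e'.1.shift e'.2 := by
  simp only [evenLinks, Finset.mem_image, Finset.mem_univ, true_and] at he he'
  obtain ⟨x, rfl⟩ := he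
  obtain ⟨x', rfl⟩ := he'
  have hxx' : x ≠ x' := fun h => hne (by rw [h])
  refine ⟨fun h => hxx' (evenSite_injective h), (evenSite_ne_shift x' x i₀),
    fun h => evenSite_ne_shift x x' i₀ h.symm, fun h => hxx' (evenSite_injective ?_)⟩
  have := congrArg (fun z : Site d L => z - Pi.single i₀ 1) h
  simpa [Site.shift] using this

/-- An `evenLinks` link is not a loop. [ours] -/
theorem evenLinks_not_loop [NeZero L] (i₀ : Fin d) {e : Edge d L} (he : e ∈ evenLinks (L := L) i₀) :
    e.1 ≠ e.1.shift e.2 := by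
  simp only [evenLinks, Finset.mem_image, Finset.mem_univ, true_and] at he
  obtain ⟨x, rfl⟩ := he
  exact evenSite_ne_shift x x i₀

/-- **Private endpoints**: every link of a sub-family `M ⊆ evenLinks i₀` no member of which touches an
endpoint of `a` has a private endpoint w.r.t. `insert a M` (indeed both endpoints are private). [ours] -/
theorem evenLinks_private [NeZero L] (i₀ : Fin d) (a : Edge d L) {M : Finset (Edge d L)}
    (hM : M ⊆ evenLinks (L := L) i₀)
    (ha : ∀ ℓ ∈ M, a.1 ≠ ℓ.1 ∧ a.1.shift a.2 ≠ ℓ.1 ∧ a.1 ≠ ℓ.1.shift ℓ.2 ∧ a.1.shift a.2 ≠ ℓ.1.shift ℓ.2) :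
    ∀ ℓ ∈ M, ℓ.1 ≠ ℓ.1.shift ℓ.2 ∧ ∃ x : Site d L, (ℓ.1 = x ∨ ℓ.1.shift ℓ.2 = x) ∧
      ∀ e : Edge d L, e.1 = x ∨ e.1.shift e.2 = x → e ≠ ℓ → e ∉ insert a M := by
  intro ℓ hℓ
  refine ⟨evenLinks_not_loop i₀ (hM hℓ), ℓ.1, Or.inl rfl, fun e he hne hmem => ?_⟩
  rcases Finset.mem_insert.1 hmem with rfl | heM
  · rcases he with h1 | h2
    · exact (ha ℓ hℓ).1 h1
    · exact (ha ℓ hℓ).2.1 h2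
  · have hd := evenLinks_endpoint_disjoint i₀ (hM heM) (hM hℓ) hne
    rcases he with h1 | h2
    · exact hd.1 h1
    · exact hd.2.2.1 h2

variable [TopologicalSpace G] [IsTopologicalGroup G] [CompactSpace G] [MeasurableSpace G]
  [BorelSpace G] (ρ : G →* Matrix (Fin N) (Fin N) ℂ)

/-- **VOLUME-ORDER COLLAPSE OF THE CONTEXT (Wilson weight, every compact `G`, `ρ`, real `β`, every
`d`, `L ≥ 2`, every direction `i₀`, every link `a`).**  Let `M` be the links of `evenLinks i₀` none of
whose endpoints is an endpoint of `a` (all `⌊L/2⌋^d` of them but the at most two at `a`'s endpoints),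
generated FIRST, and `a ∉ M` generated next (`s = (insert a M)ᶜ` still to come).  Then the exact
conditional density of `U_a` given `U_M`, `A_s w / A_{insert a s} w` with `w = e^{−β S_W}`, takes the
same value on any two configurations agreeing off `insert a M`: it is constant in `(U_a, U_M)` — `U_a`
is exactly Haar and reads none of the `≍ (L/2)^d` generated links. [ours] -/
theorem wilson_arConditional_const_after_evenLinks [NeZero L] (hL : 2 ≤ L) (β : ℝ) (i₀ : Fin d)
    (a : Edge d L) {M : Finset (Edge d L)} (hM : M ⊆ evenLinks (L := L) i₀)
    (ha : ∀ ℓ ∈ M, a.1 ≠ ℓ.1 ∧ a.1.shift a.2 ≠ ℓ.1 ∧ a.1 ≠ ℓ.1.shift ℓ.2 ∧ a.1.shift a.2 ≠ ℓ.1.shift ℓ.2)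
    {U U' : GaugeConfig d L G} (h : ∀ e, e ∉ insert a M → U e = U' e) :
    let w : GaugeConfig d L G → ℝ := fun U => Real.exp (-β * wilsonAction ρ U)
    let s : Finset (Edge d L) := Finset.univ \ insert a M
    coordAvg (haarProbability G) s w U / coordAvg (haarProbability G) (insert a s) w U =
      coordAvg (haarProbability G) s w U' / coordAvg (haarProbability G) (insert a s) w U' := by
  intro w s
  haveI : Fact (1 < L) := ⟨hL⟩
  have hw : IsGaugeInvariant w := fun γ V => by simp only [w, wilsonAction_gaugeTransform]
  have haM : a ∉ M := fun haM => (ha a haM).1 rfl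
  have hloop : a.1 ≠ a.1.shift a.2 := by
    intro h
    have h1 : a.1 a.2 = (a.1.shift a.2) a.2 := by rw [← h]
    simp [Site.shift] at h1
  have hy : ∀ e ∈ M, ¬ (e.1 = a.1 ∨ e.1.shift e.2 = a.1) := by
    rintro e he (h1 | h2)
    · exact (ha e he).1 h1.symm
    · exact (ha e he).2.2.1 h2.symm
  exact arConditional_const_of_private_endpoints hw M haM (evenLinks_private i₀ a hM ha) hloop
    (Or.inl rfl) hy h

end EvenLinks

end Summit.Ventures.LatticeQCDFlow.Theory2.Autoregressive

end
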